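import Mathlib
import Summits.Parity.GeneralizedHardyLittlewood.Theses.LiouvilleShiftedTables
import Literature.NumberTheory.Sieve.SingularSeries
import Literature.NumberTheory.Sieve.LevelOfDistribution

/-!
# Crux `EngineToPairs` (stmt-Parity-14659) — ideator 2 sketch (crux-ideate round 1)

Route `LiouvilleShiftedTables`; crux decl
`Summit.Parity.GeneralizedHardyLittlewood.Theses.LiouvilleShiftedTables.EngineToPairs`
`= DilatedTableChowla → TypeI2Dilated → ElliottHalberstam → (∀ h ≥ 1, PairsHL h)` (route rev 9).

Contents (everything elaborates; `sorry` nowhere):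
* §0 the crux restated (`EngineToPairs'`, definitionally the route decl on rev ≥ 9 of the file; the
  farm snapshot used for this check still has rev 8 without the decl, hence the local copy);
* §1 the WAIST of both idea cards: `T X q h = Σ_{n ≤ X, n ≡ h (q)} Λ(n) λ(n - h)` and the level-`ε`
  Bombieri–Vinogradov statements `TAvg h` (single height) / `TAvgUnif h` (per-modulus heights),
  `tavg_of_unif`;
* §2 the two halves `EngineToTAvg`, `PairsFromTAvg` (+ `TAvgToMAvg`) and the kernel-checked
  compositions `engineToPairs'_of`, `sieveToMAvg_of` (pure logic);
* §3 FIRST LEMMA of card `two-type-window-dispatcher`: the subset-sum WINDOW LEMMA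
  (Matomäki–Radziwiłł–Tao 2019 Lemma 2.15 with `m = 3`, in exponent form), PROVED;
* §4 FIRST LEMMA of card `bombieri-cut-on-proved-rails`: the Euler factor of `𝔖({0,h})` IS
  `(1 - g_h(p))/(1 - 1/p)` for the shifted-prime density `g_h = shiftedPrimesDensity h`, PROVED, whence
  `singularSeriesPartial {0,h} x = ∏_{p ≤ x} (1 - g_h p)/(1 - p⁻¹)` — the `H` of the PROVED tree fact
  `fi_moebius_density_log_sum_holds` is the route's singular series;
* §5 the log-power strengthening `PairsLogPowerAt` (C⁺ of the Transfer field) and `pairsHLAt_of_logPower`.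
-/

namespace Summit.Parity.GeneralizedHardyLittlewood.Cruxes.EngineToPairs.Ideator2

open Finset Real Filter Asymptotics
open scoped ArithmeticFunction.vonMangoldt ArithmeticFunction.Moebius
open Summit.Parity.GeneralizedHardyLittlewood.Theses.LiouvilleShiftedTables
open Literature.NumberTheory.Sieve

/-! ### §0 The crux, restated -/

/-- Hardy–Littlewood pairs at ONE shift `h` (the conclusion of the crux, `PairsHL` un-∀-ed). -/
def PairsHLAt (h : ℕ) : Prop :=
  (fun N : ℕ => ∑ n ∈ Icc 1 N, Λ n * Λ (n + h) -
      singularSeries ({0, (h : ℤ)} : Finset ℤ) * N) =o[atTop] fun N : ℕ => (N : ℝ)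

/-- The crux, verbatim (route file rev 9): `X1 → X2 → EH → pairs at every shift`. -/
def EngineToPairs' : Prop :=
  DilatedTableChowla → TypeI2Dilated → ElliottHalberstam → ∀ h : ℕ, 1 ≤ h → PairsHLAt h

/-- `PairsHL` of the route is `∀ h ≥ 1, PairsHLAt h` (definitional). -/
example : PairsHL ↔ ∀ h : ℕ, 1 ≤ h → PairsHLAt h := Iff.rfl

/-! ### §1 The waist: `T`-sums and level-`ε` Bombieri–Vinogradov for `Λ(n) λ(n - h)` -/

/-- `T(X; q, h) = Σ_{1 ≤ n ≤ X, n ≡ h (mod q)} Λ(n) λ(n - h)` (truncated subtraction: the terms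
`n ≤ h` carry `λ(0) = 0`). The parity object both halves meet at. -/
noncomputable def T (X : ℝ) (q h : ℕ) : ℝ :=
  ∑ n ∈ (Icc 1 ⌊X⌋₊).filter (fun n : ℕ => n ≡ h [MOD q]),
    Λ n * (ArithmeticFunction.liouville (n - h) : ℝ)

/-- `TAvg h`: for some `ε > 0` and every `B`, `Σ_{q ≤ X^ε} |T(X; q, h)| ≤ X/(log X)^B` for large `X`
(single height). Consumed by the EH half; trivially `≍ X log X^ε`. -/
def TAvg (h : ℕ) : Prop :=
  ∃ ε : ℝ, 0 < ε ∧ ∀ B : ℝ, 0 < B → ∃ X₀ : ℝ, ∀ X : ℝ, X₀ ≤ X →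
    ∑ q ∈ Icc 1 ⌊X ^ ε⌋₊, |T X q h| ≤ X / Real.log X ^ B

/-- `TAvgUnif h`: the same with an arbitrary height `X' q ≤ X` per modulus (what the fine-box
dispatcher proves at no extra cost; needed by the Selberg-cut variant of the EH half). -/
def TAvgUnif (h : ℕ) : Prop :=
  ∃ ε : ℝ, 0 < ε ∧ ∀ B : ℝ, 0 < B → ∃ X₀ : ℝ, ∀ X : ℝ, X₀ ≤ X → ∀ X' : ℕ → ℝ, (∀ q, X' q ≤ X) →
    ∑ q ∈ Icc 1 ⌊X ^ ε⌋₊, |T (X' q) q h| ≤ X / Real.log X ^ B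

theorem tavg_of_unif {h : ℕ} (hU : TAvgUnif h) : TAvg h := by
  obtain ⟨ε, hε, hB⟩ := hU
  refine ⟨ε, hε, fun B hBpos => ?_⟩
  obtain ⟨X₀, hX₀⟩ := hB B hBpos
  exact ⟨X₀, fun X hX => hX₀ X hX (fun _ => X) (fun _ => le_rfl)⟩

/-! ### §2 The two halves and their composition -/

/-- ENGINE HALF (card `two-type-window-dispatcher`): the parity engine gives level-`ε`
Bombieri–Vinogradov for `Λ(n)λ(n-h)`, per-modulus heights included. `BVLiouville` is NOT a hypothesis. -/
def EngineToTAvg : Prop :=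
  DilatedTableChowla → TypeI2Dilated → ∀ h : ℕ, 1 ≤ h → TAvgUnif h

/-- EH HALF (card `bombieri-cut-on-proved-rails`): Bombieri's single-height cut + the λ-flip. -/
def PairsFromTAvg : Prop :=
  ElliottHalberstam → ∀ h : ℕ, 1 ≤ h → TAvg h → PairsHLAt h

/-- The `K`-step (`μ(d) = Σ_{k² ∣ d} μ(k) λ(d)`, `λ((p-h)/m) = λ(m) λ(p-h)`): TAvg at level `2ε` and
saving `B + 5` gives the route's `MAvg` (stmt-0613 shape) at level `ε`. -/
def TAvgToMAvg : Prop :=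
  (∀ h : ℕ, 1 ≤ h → TAvg h) → MAvg

/-- The crux from the two halves (pure logic). -/
theorem engineToPairs'_of (hE : EngineToTAvg) (hP : PairsFromTAvg) : EngineToPairs' :=
  fun hD hI hEH h hh => hP hEH h hh (tavg_of_unif (hE hD hI h hh))

/-- Bonus: the same engine half closes the route's support item `SieveToMAvg` (stmt-14274),
with `BVLiouville` unused. -/
theorem sieveToMAvg_of (hE : EngineToTAvg) (hK : TAvgToMAvg) : SieveToMAvg :=
  fun hD hI _hB => hK (fun h hh => tavg_of_unif (hE hD hI h hh))

/-! ### §3 First lemma of card `two-type-window-dispatcher`: the window lemma (PROVED)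

Exponent form of the dispatcher: `t i = log N_i / log X` for the fine boxes `N_i` of the `2K`
variables of a Heath-Brown piece (`K ≥ 2/δ`, so every `μ`-variable has `t < δ` and only smooth
variables can be large). Either some sub-product sits in the Type-II window `[δ, 1/3 + δ]`
(→ `DilatedTableChowla`, after `a :=` that sub-product or its complement), or the variables above
the window number one or two (necessarily smooth) and everything else multiplies to `< X^δ`
(→ `TypeI2Dilated` with `r :=` the smalls, `s :=` the second large variable or `1`, `n :=` the
largest). This is Matomäki–Radziwiłł–Tao, PLMS 118 (2019) Lemma 2.15 with `m = 3`, `H₀ = X^{1/3+δ}`. -/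

theorem window_lemma' {ι : Type*} [Fintype ι] [DecidableEq ι] {lo hi : ℝ} (hlo0 : 0 < lo)
    (h2 : 2 * lo ≤ hi) {t : ι → ℝ} (ht : ∀ i, 0 ≤ t i) (hlo : lo ≤ ∑ i, t i)
    (hhi : ∑ i, t i ≤ 3 * hi) :
    (∃ S : Finset ι, lo ≤ ∑ i ∈ S, t i ∧ ∑ i ∈ S, t i ≤ hi) ∨
    ((univ.filter fun i => hi < t i).Nonempty ∧
      (univ.filter fun i => hi < t i).card ≤ 2 ∧
      ∑ i ∈ univ.filter (fun i => t i ≤ hi), t i < lo) := by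
  classical
  by_cases hW : ∃ S : Finset ι, lo ≤ ∑ i ∈ S, t i ∧ ∑ i ∈ S, t i ≤ hi
  · exact Or.inl hW
  right
  push Not at hW
  -- every subset of the "not large" coordinates has sum `< lo` (greedy)
  have hsmall : ∀ S : Finset ι, S ⊆ univ.filter (fun i => t i ≤ hi) →
      ∑ i ∈ S, t i < lo := by
    intro S
    induction S using Finset.induction_on with
    | empty => intro; simpa using hlo0
    | insert j S hjS ih =>
      intro hsub
      have hjP := hsub (mem_insert_self j S)
      have hSP : S ⊆ univ.filter (fun i => t i ≤ hi) :=
        fun i hi' => hsub (mem_insert_of_mem hi')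
      have hS := ih hSP
      have htj : t j ≤ hi := (mem_filter.mp hjP).2
      have htj' : t j < lo := by
        by_contra hc
        push Not at hc
        have h1 := hW {j} (by simpa using hc)
        rw [sum_singleton] at h1
        linarith
      rw [sum_insert hjS]
      by_contra hc
      push Not at hc
      have h2' := hW (insert j S) (by rwa [sum_insert hjS])
      rw [sum_insert hjS] at h2'
      linarith
  have hPsum : ∑ i ∈ univ.filter (fun i => t i ≤ hi), t i < lo := hsmall _ subset_rfl
  have hsplit : ∑ i, t i = ∑ i ∈ univ.filter (fun i => t i ≤ hi), t i +
      ∑ i ∈ univ.filter (fun i => hi < t i), t i := by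
    rw [← sum_filter_add_sum_filter_not univ (fun i => t i ≤ hi) t]
    congr 1
    refine sum_congr ?_ fun _ _ => rfl
    ext i
    simp [not_le]
  refine ⟨?_, ?_, hPsum⟩
  · by_contra hne
    rw [not_nonempty_iff_eq_empty] at hne
    rw [hne, sum_empty, add_zero] at hsplit
    linarith
  · by_contra hc
    push Not at hc
    obtain ⟨L', hL'sub, hcard⟩ :=
      exists_subset_card_eq (show 3 ≤ (univ.filter fun i => hi < t i).card by omega)
    have hmem : ∀ i ∈ L', hi < t i := fun i hi' => (mem_filter.mp (hL'sub hi')).2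
    have hne : L'.Nonempty := by rw [← card_pos, hcard]; norm_num
    have h3 : ∑ i ∈ L', hi < ∑ i ∈ L', t i := sum_lt_sum_of_nonempty hne hmem
    rw [sum_const, hcard, nsmul_eq_mul] at h3
    have hL'le : ∑ i ∈ L', t i ≤ ∑ i, t i := sum_le_univ_sum_of_nonneg ht
    push_cast at h3
    linarith

/-- The instance used by the card: window `[δ, 1/3 + δ]` (`lo = δ`, `hi = 1/3 + δ`; in the dispatcher
`δ = 2δ'` with `δ'` the parameter at which `DilatedTableChowla` is applied). -/
theorem window_lemma {ι : Type*} [Fintype ι] [DecidableEq ι] {δ : ℝ} (hδ : 0 < δ)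
    (hδ3 : δ ≤ 1 / 3) {t : ι → ℝ} (ht : ∀ i, 0 ≤ t i) (hlo : δ ≤ ∑ i, t i)
    (hhi : ∑ i, t i ≤ 1 + 3 * δ) :
    (∃ S : Finset ι, δ ≤ ∑ i ∈ S, t i ∧ ∑ i ∈ S, t i ≤ 1 / 3 + δ) ∨
    ((univ.filter fun i => 1 / 3 + δ < t i).Nonempty ∧
      (univ.filter fun i => 1 / 3 + δ < t i).card ≤ 2 ∧
      ∑ i ∈ univ.filter (fun i => t i ≤ 1 / 3 + δ), t i < δ) :=
  window_lemma' hδ (by linarith) ht hlo (by linarith)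

/-! ### §4 First lemma of card `bombieri-cut-on-proved-rails`: the main-term constant IS `𝔖({0,h})`

`g_h := shiftedPrimesDensity h` (`d ↦ [(d,h)=1]/φ(d)`) is the density of `a_n = Λ(n+h)` in the tree
(`LevelOfDistribution.lean`; `bombieriA2_shiftedPrimesCounting : h ≠ 0 → ElliottHalberstam → (A₂)`
PROVED). The PROVED FI-ASP rails `fi_moebius_density_log_sum_holds` /
`tendsto_sum_coprime_moebius_mul_log` give `Σ_b μ(b) g_h(b) log b → -H` with
`∏_{p ≤ x} (1 - g_h p)/(1 - 1/p) → H`; the lemma below says that partial product IS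
`singularSeriesPartial {0,h} x`, so `H = singularSeries {0,h}` by the PROVED
`exists_abs_singularSeries_sub_partial_le`. -/

/-- `ν_{{0,h}}(p) = 1` if `p ∣ h`, else `2` (`p` prime, `h ≠ 0`). -/
theorem tupleResidueCount_pair {h p : ℕ} (_hp : p.Prime) (_hh : h ≠ 0) :
    tupleResidueCount ({0, (h : ℤ)} : Finset ℤ) p = if p ∣ h then 1 else 2 := by
  unfold tupleResidueCount
  rw [Finset.image_insert, Finset.image_singleton, Int.cast_zero, Int.cast_natCast]
  by_cases hdvd : p ∣ h
  · have h0 : ((h : ℕ) : ZMod p) = 0 := (ZMod.natCast_eq_zero_iff h p).mpr hdvd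
    rw [if_pos hdvd, h0, Finset.insert_eq_of_mem (Finset.mem_singleton_self _), Finset.card_singleton]
  · have h0 : ((h : ℕ) : ZMod p) ≠ 0 := fun hc => hdvd ((ZMod.natCast_eq_zero_iff h p).mp hc)
    rw [if_neg hdvd]
    exact Finset.card_pair (Ne.symm h0)

/-- **The Euler factor of `𝔖({0,h})` is the FI density-constant factor of `g_h`.** For `p` prime and
`h ≠ 0`: `(1 - ν(p)/p)(1 - 1/p)⁻² = (1 - g_h(p))/(1 - p⁻¹)` with `g_h = shiftedPrimesDensity h`. -/
theorem singularSeriesFactor_pair_eq_density {h p : ℕ} (hp : p.Prime) (hh : h ≠ 0) :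
    singularSeriesFactor ({0, (h : ℤ)} : Finset ℤ) p =
      (1 - shiftedPrimesDensity h p) / (1 - ((p : ℝ))⁻¹) := by
  have hp1 : (1 : ℝ) < p := by exact_mod_cast hp.one_lt
  have hp0 : (p : ℝ) ≠ 0 := by positivity
  have hp1' : (p : ℝ) - 1 ≠ 0 := by linarith
  have hcard : ({0, (h : ℤ)} : Finset ℤ).card = 2 :=
    Finset.card_pair (by exact_mod_cast (Ne.symm hh))
  have hdens : shiftedPrimesDensity h p =
      if p.Coprime h ∧ p ≠ 0 then ((Nat.totient p : ℝ))⁻¹ else 0 := rfl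
  unfold singularSeriesFactor
  rw [tupleResidueCount_pair hp hh, hcard, hdens, Nat.totient_prime hp]
  by_cases hdvd : p ∣ h
  · have hnc : ¬ (p.Coprime h ∧ p ≠ 0) := fun hc =>
      ((Nat.Prime.coprime_iff_not_dvd hp).mp hc.1) hdvd
    rw [if_pos hdvd, if_neg hnc]
    push_cast
    field_simp
    ring
  · have hc : p.Coprime h ∧ p ≠ 0 := ⟨(Nat.Prime.coprime_iff_not_dvd hp).mpr hdvd, hp.ne_zero⟩
    rw [if_neg hdvd, if_pos hc]
    have h2 : ((2 : ℕ) : ℝ) = 2 := by norm_num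
    push_cast [Nat.cast_sub hp.one_le]
    field_simp
    ring

/-- Hence the ordered partial products agree termwise with FI's density-constant products. -/
theorem singularSeriesPartial_pair_eq_density {h : ℕ} (hh : h ≠ 0) (x : ℕ) :
    singularSeriesPartial ({0, (h : ℤ)} : Finset ℤ) x =
      ∏ p ∈ Nat.primesLE x, (1 - shiftedPrimesDensity h p) / (1 - ((p : ℝ))⁻¹) :=
  Finset.prod_congr rfl fun _ hp => singularSeriesFactor_pair_eq_density (Nat.prime_of_mem_primesLE hp) hh

/-! ### §5 The log-power strengthening (C⁺ of the Transfer field) -/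

/-- Hardy–Littlewood pairs at shift `h` with an arbitrary power-of-log error term — what the line
actually outputs (EH, the engine, the shells and the Möbius–density rails all save powers of log). -/
def PairsLogPowerAt (h : ℕ) : Prop :=
  ∀ B : ℝ, 0 < B → ∃ C : ℝ, ∃ N₀ : ℕ, ∀ N : ℕ, N₀ ≤ N →
    |∑ n ∈ Icc 1 N, Λ n * Λ (n + h) - singularSeries ({0, (h : ℤ)} : Finset ℤ) * N| ≤
      C * N / Real.log N ^ B

theorem pairsHLAt_of_logPower {h : ℕ} (hP : PairsLogPowerAt h) : PairsHLAt h := by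
  obtain ⟨C, N₀, hC⟩ := hP 1 one_pos
  rw [PairsHLAt, Asymptotics.isLittleO_iff]
  intro c hc
  -- for `N ≥ max N₀ (exp (|C|/c))`: `C N / log N ≤ |C| N / log N ≤ c N`
  have hev : ∀ᶠ N : ℕ in atTop, N₀ ≤ N ∧ Real.exp (|C| / c + 1) ≤ (N : ℝ) := by
    refine (eventually_ge_atTop N₀).and ?_
    exact (tendsto_natCast_atTop_atTop (R := ℝ)).eventually_ge_atTop _
  filter_upwards [hev] with N ⟨hN₀, hNexp⟩
  have hN1 : (1 : ℝ) < N := lt_of_lt_of_le (by have := Real.one_lt_exp_iff.mpr (show 0 < |C| / c + 1 by positivity); linarith [Real.add_one_le_exp (|C| / c + 1)]) hNexp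
  have hlog : |C| / c + 1 ≤ Real.log N := by
    have := Real.log_le_log (Real.exp_pos _) hNexp
    rwa [Real.log_exp] at this
  have hlogpos : 0 < Real.log N := by
    have : 0 < |C| / c + 1 := by positivity
    linarith
  have hNpos : (0 : ℝ) < N := by linarith
  have hb := hC N hN₀
  rw [Real.rpow_one] at hb
  rw [Real.norm_eq_abs, Real.norm_eq_abs, abs_of_pos hNpos]
  calc |∑ n ∈ Icc 1 N, Λ n * Λ (n + h) - singularSeries ({0, (h : ℤ)} : Finset ℤ) * N|
      ≤ C * N / Real.log N := hb
    _ ≤ |C| * N / Real.log N := by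
        gcongr
        exact le_abs_self C
    _ ≤ c * N := by
        rw [div_le_iff₀ hlogpos]
        have h1 : |C| ≤ c * (|C| / c + 1) := by
          rw [mul_add, mul_div_cancel₀ _ (ne_of_gt hc)]; linarith
        calc |C| * N ≤ c * (|C| / c + 1) * N := by gcongr
          _ ≤ c * Real.log N * N := by gcongr
          _ = c * N * Real.log N := by ring

end Summit.Parity.GeneralizedHardyLittlewood.Cruxes.EngineToPairs.Ideator2
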